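import Literature.Analysis.FluidPDE.FluidComputer.CircuitArchitecture
import Literature.Analysis.FluidPDE.OnsagerBDSVTransportEstimates
import HarnessLib

/-!
# Fluid computer blueprint — the LOCAL layer: guarded infinitesimal dynamics of a circuit design

HONEST FRAMING: low prior, high value-of-information experiment on Tao's machine paradigm; NOT a
claim that NS blows up. Nothing in this file constructs a design; every theorem is an implication
from a structure that, as far as anyone knows, is uninhabited for the true equations.

`CircuitArchitecture.lean` types Tao's machine (J. Amer. Math. Soc. 29 (2016), §1.3) as a
`ShadowedCircuit S O s`: a finite-dimensional circuit `Φ` on an observable space `O` plus two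
DYNAMICS axioms about every `H¹⁰_df`-mild Navier–Stokes trajectory — `shadow` (the readout stays
`δsh`-close to the circuit orbit for a WHOLE tick) and `leak` (the junk stays below the running
threshold for a WHOLE tick) — both GLOBAL in the tick and UNGUARDED (claimed whatever the state has
become). Those are exactly the two fields a fluid-mechanical argument cannot deliver in that form: a
perturbative estimate holds only WHILE the state is near the design, and what it delivers is an
INSTANTANEOUS inequality (a bound on a time derivative), not a whole-tick conclusion.

## The structure `LocalCircuit S O s`

This file replaces the two whole-tick axioms by two LOCAL, GUARDED ones and derives the whole-tick
statements by a bootstrap (continuous induction). The observable space `O` is now a real normed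
space and the circuit comes with its VECTOR FIELD:

* CIRCUIT (finite-dimensional, certifiable by validated numerics for a concrete design): a vector
  field `F` that is `L`-Lipschitz on an OPEN working region `U ⊆ O`; its flow `Φ` from `Ain` for
  rescaled time `[0, τc]` (`flow_zero`, `flow_cont`, `flow_deriv`); a TUBE condition — the closed
  `δsh`-neighbourhood of every orbit point `Φ σ p`, `p ∈ Ain`, `σ ≤ τc`, lies in `U` (`tube`); the
  delayed abrupt transition with margin (`dat`, as before); and the DEFECT BUDGET
  `gronwallBound 0 L ε τc ≤ δsh` (`δsh_ge`), i.e. `ε (e^{L τc} - 1)/L ≤ δsh`: the tube radius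
  absorbs a defect of size `ε` per unit rescaled time amplified by the circuit's own instability
  `e^{L τc}` (sufficient: `ε τc e^{L τc} ≤ δsh`, `gronwallBound_le_of_budget`).
* LEAK BUDGET (arithmetic): a junk growth rate `γ ≥ 0` with `jin + γ τc ≤ jrun < jbar` (`jbar` =
  the junk ceiling of the working region).
* DYNAMICS (idea-bound, but now LOCAL and GUARDED — the form a triad / pressure estimate takes):
  for every `H¹⁰_df`-mild trajectory `u` on `[0, S')`, at every instant `t` at which the state is
  in the generation-`n` WORKING REGION (`read n (u t) ∈ U` and `junk n (u t) < jbar √E_n`):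
  `defect` — the readout has a right time-derivative `W` with `‖unit n • W - F (read n (u t))‖ ≤ ε`
  (in rescaled units the true readout velocity is `ε`-close to the circuit's); `junk_rate` — the
  lower right Dini derivative of the junk is `≤ γ √E_n / unit n`
  (`∀ ρ > γ, ∃ᶠ t' → t⁺, junk n (u t') ≤ junk n (u t) + ρ √E_n (t' - t)/unit n`).
* READOUT / REGIONS / STATICS / CLOCK / SEED: verbatim the fields of `ShadowedCircuit`, plus the
  order restriction `s ≤ 10` (junk measured in `X^s_{λ_n}` with `s ≤ 10` is continuous along an
  `H¹⁰`-continuous trajectory — the one place the regularity class of the mild theory is used).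

## What is DERIVED (soft, unconditional given the structure)

* `LocalCircuit.dist_le_gronwallBound_of_guard` — GUARDED SHADOWING (Gronwall for approximate
  trajectories, Mathlib's `dist_le_of_approx_trajectories_ODE_of_mem`, run in rescaled time): while
  the state stays in the working region, the readout is within `gronwallBound 0 L ε σ` of the
  circuit orbit after rescaled time `σ`;
* `LocalCircuit.junk_toReal_le_of_guard` — GUARDED LEAKAGE (a Dini-derivative fence): meanwhile
  the junk grows at most linearly at rate `γ √E_n / unit n`;
* the bootstrap closing the guard (`shadow_leak_sharp`: both bounds keep the state inside the
  working region, which is open, so the guarded estimates extend — continuous induction on the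
  tick), the unguarded whole-tick `shadow` / `leak`, and `LocalCircuit.toShadowedCircuit` are in
  `LocalCircuitShadowing.lean`; everything downstream of `ShadowedCircuit` (realisation,
  self-replication, explicit noise tolerance, liveness, finite lifespan `≤ T_*`) follows.

## Honest ceiling

As an abstract type the structure is no harder to inhabit than `ShadowedCircuit` from a live,
uniformly stable clocked blow-up orbit with a `C¹` phase readout; its teeth are again in the
CONCRETE reading (`O = ℝ^m` = coefficients of finitely many design modes at scale `λ_n`, `F` = the
Galerkin truncation of the Euler nonlinearity at one scale in rescaled variables), where `F_lip`,
`flow_*`, `tube`, `dat`, `δsh_ge` are ONE finite-dimensional validated computation, and `defect` /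
`junk_rate` are two scalar a-priori inequalities about the true flow near a finite-dimensional
invariant-looking set: the defect `ε` is the size, in rescaled units, of (off-design triad input
into the design modes) + (viscous term `∼ ν λ_n² unit n = viscousNumber`), and `γ` the rate at which
design modes feed non-design ones. Nothing here asserts they hold. [cite: Tao2016AveragedNS, §1.3 pp. 10–11]
-/

noncomputable section

open MeasureTheory Set Filter Topology
open scoped ENNReal NNReal SchwartzMap

namespace Literature.Analysis.FluidPDE.FluidComputer

open Literature.Analysis.FluidPDE.Tao2016
open Literature.Analysis.FunctionSpaces (eFourierSobolevNorm)

/-! ### §0. Two pieces of arithmetic: the defect budget and the junk modulus -/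

/-- Lower bound for the Grönwall bound from zero initial error: `ε x ≤ gronwallBound 0 K ε x`
(`K, ε ≥ 0`; `e^{Kx} - 1 ≥ Kx`). In words: a tube of radius `δsh` over rescaled time `τc`
admits a defect of at most `δsh / τc` per unit time. [folklore] -/
theorem mul_le_gronwallBound_δ0 {K ε x : ℝ} (hK : 0 ≤ K) (hε : 0 ≤ ε) :
    ε * x ≤ gronwallBound 0 K ε x := by
  rcases eq_or_lt_of_le hK with rfl | hK0
  · simp [gronwallBound_K0]
  · rw [gronwallBound_of_K_ne_0 hK0.ne']
    simp only [zero_mul, zero_add]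
    have h1 : K * x + 1 ≤ Real.exp (K * x) := Real.add_one_le_exp _
    have h2 : ε * x = ε / K * (K * x) := by field_simp
    rw [h2]
    exact mul_le_mul_of_nonneg_left (by linarith) (div_nonneg hε hK0.le)

/-- **The defect budget**: a defect `ε` per unit rescaled time with `ε τc e^{L τc} ≤ δsh` keeps the
Grönwall bound over rescaled time `τc` inside the tube radius `δsh`
(`gronwallBound 0 K ε x ≤ ε x e^{Kx}`, `BDSV.gronwallBound_zero_le`). [folklore] -/
theorem gronwallBound_le_of_budget {K ε x δsh : ℝ} (hK : 0 ≤ K) (hε : 0 ≤ ε)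
    (h : ε * x * Real.exp (K * x) ≤ δsh) : gronwallBound 0 K ε x ≤ δsh :=
  (BDSV.gronwallBound_zero_le hK hε).trans h

/-- **Scale comparison for the scale-adapted Sobolev norms** (`s ≥ 0`, `κ > 0`):
`‖f‖_{X^s_κ} ≤ max(1, κ⁻²)^{s/2} ‖f‖_{H^s}` (`1 + |ξ|²/κ² ≤ max(1,κ⁻²) (1 + |ξ|²)`). [cite: BahouriCheminDanchin2011, §1.4.1] -/
theorem scaledSobolevNorm_le_mul_eFourierSobolevNorm {s κ : ℝ} (hs : 0 ≤ s) (hκ : 0 < κ)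
    (f : L2C) :
    scaledSobolevNorm s κ f ≤
      ENNReal.ofReal ((max 1 (κ ^ 2)⁻¹) ^ s) ^ (1 / 2 : ℝ) * eFourierSobolevNorm s f := by
  rw [← scaledSobolevNorm_one]
  unfold scaledSobolevNorm
  set M : ℝ := max 1 (κ ^ 2)⁻¹ with hM
  have hM1 : 1 ≤ M := le_max_left _ _
  have hM0 : 0 ≤ M := zero_le_one.trans hM1
  have hw : ∀ ξ : EuclideanSpace ℝ (Fin 3), ENNReal.ofReal ((1 + ‖ξ‖ ^ 2 / κ ^ 2) ^ s) ≤
      ENNReal.ofReal (M ^ s) * ENNReal.ofReal ((1 + ‖ξ‖ ^ 2 / 1 ^ 2) ^ s) := by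
    intro ξ
    have ha : 0 ≤ ‖ξ‖ ^ 2 := sq_nonneg _
    have h0 : 0 ≤ 1 + ‖ξ‖ ^ 2 / κ ^ 2 := by positivity
    rw [one_pow, div_one, ← ENNReal.ofReal_mul (Real.rpow_nonneg hM0 s),
      ← Real.mul_rpow hM0 (by positivity)]
    refine ENNReal.ofReal_le_ofReal (Real.rpow_le_rpow h0 ?_ hs)
    have h1 : ‖ξ‖ ^ 2 / κ ^ 2 ≤ M * ‖ξ‖ ^ 2 := by
      rw [div_eq_mul_inv, mul_comm]
      exact mul_le_mul_of_nonneg_right (le_max_right _ _) ha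
    calc 1 + ‖ξ‖ ^ 2 / κ ^ 2 ≤ M + M * ‖ξ‖ ^ 2 := add_le_add hM1 h1
      _ = M * (1 + ‖ξ‖ ^ 2) := by ring
  calc (∫⁻ ξ, ENNReal.ofReal ((1 + ‖ξ‖ ^ 2 / κ ^ 2) ^ s) * ‖fourierFn f ξ‖ₑ ^ 2) ^ (1 / 2 : ℝ)
      ≤ (∫⁻ ξ, ENNReal.ofReal (M ^ s) *
          (ENNReal.ofReal ((1 + ‖ξ‖ ^ 2 / 1 ^ 2) ^ s) * ‖fourierFn f ξ‖ₑ ^ 2)) ^ (1 / 2 : ℝ) := by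
        refine ENNReal.rpow_le_rpow (lintegral_mono fun ξ => ?_) (by norm_num)
        rw [← mul_assoc]
        exact mul_le_mul' (hw ξ) le_rfl
    _ = ENNReal.ofReal (M ^ s) ^ (1 / 2 : ℝ) *
          (∫⁻ ξ, ENNReal.ofReal ((1 + ‖ξ‖ ^ 2 / 1 ^ 2) ^ s) * ‖fourierFn f ξ‖ₑ ^ 2) ^ (1 / 2 : ℝ) := by
        rw [lintegral_const_mul' _ _ ENNReal.ofReal_ne_top,
          ENNReal.mul_rpow_of_nonneg _ _ (by norm_num : (0 : ℝ) ≤ 1 / 2)]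

namespace CascadeSpecs

/-- The **junk modulus** of generation `n`: the constant `C_n = max(1, λ_n⁻²)^5` with
`‖·‖_{X^{10}_{λ_n}} ≤ C_n ‖·‖_{H¹⁰}` (`scaledSobolevNorm_le_mul_eFourierSobolevNorm`). [folklore] -/
def junkModulus (S : CascadeSpecs) (n : ℕ) : ℝ≥0∞ :=
  ENNReal.ofReal ((max 1 (S.lam n ^ 2)⁻¹) ^ (10 : ℝ)) ^ (1 / 2 : ℝ)

/-- The junk modulus is finite. [folklore] -/
theorem junkModulus_ne_top (S : CascadeSpecs) (n : ℕ) : S.junkModulus n ≠ ⊤ :=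
  ENNReal.rpow_ne_top_of_nonneg (by norm_num) ENNReal.ofReal_ne_top

end CascadeSpecs

/-! ### §1. The structure: a circuit design with guarded local dynamics -/

/-- **A circuit design with LOCAL, GUARDED dynamics** for Tao's machine over the spec sheet `S`,
with finite-dimensional observable space `O` (a real normed space) and junk measured in `X^s`,
`s ≤ 10`. READOUT / REGIONS / STATICS / CLOCK / SEED are the fields of `ShadowedCircuit`; CIRCUIT
now carries the vector field `F` (Lipschitz on an open working region `U`), its flow `Φ` from `Ain`,
the tube condition and the defect budget `gronwallBound 0 L ε τc ≤ δsh`; the LEAK BUDGET is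
`jin + γ τc ≤ jrun < jbar`; and the two DYNAMICS fields are instantaneous and guarded: `defect`
(while in the working region the readout's right derivative, in rescaled units, is `ε`-close to
`F`) and `junk_rate` (meanwhile the junk's lower right Dini derivative is `≤ γ √E_n / unit n`).
The whole-tick `shadow` / `leak` of `ShadowedCircuit` are THEOREMS of these
(`LocalCircuitShadowing.lean`). Nothing asserts such a design exists. [cite: Tao2016AveragedNS, §1.3 pp. 10–11] -/
structure LocalCircuit (S : CascadeSpecs) (O : Type*) [NormedAddCommGroup O] [NormedSpace ℝ O]
    (s : ℝ) where
  /-- READOUT: the generation-`n` observable of a state (rescaled units) -/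
  read : ℕ → L2C → O
  /-- the clean design state of generation `n` with a given readout -/
  recon : ℕ → O → L2C
  /-- the size of the non-design ("junk") part of a state at generation `n` -/
  junk : ℕ → L2C → ℝ≥0∞
  /-- Lipschitz modulus of the readouts -/
  Λ : ℝ
  Λ_pos : 0 < Λ
  /-- the readout of generation `n` is `Λ`-Lipschitz from `L²` measured in units of `√E_n` -/
  read_lip : ∀ (n : ℕ) (v w : L2C), dist (read n v) (read n w) * Real.sqrt (S.Emin n) ≤ Λ * ‖v - w‖
  /-- the junk functional of generation `n` is `1`-Lipschitz in `X^s` at scale `λ_n` -/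
  junk_perturb : ∀ (n : ℕ) (v w : L2C), junk n w ≤ junk n v + scaledSobolevNorm s (S.lam n) (w - v)
  /-- the junk order is at most the regularity of the mild theory -/
  s_le_ten : s ≤ 10
  /-- design states read as designed -/
  read_recon : ∀ (n : ℕ) (p : O), read n (recon n p) = p
  /-- design states carry no junk -/
  junk_recon : ∀ (n : ℕ) (p : O), junk n (recon n p) = 0
  /-- REGIONS: admissible input readouts -/
  Ain : Set O
  /-- loaded-core readouts (where a fresh generation starts) -/
  Acore : Set O
  /-- output readouts (where a generation hands off) -/
  Aout : Set O
  /-- thickness of the core inside the input region -/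
  δ : ℝ
  δ_pos : 0 < δ
  core_thick : ∀ p ∈ Acore, Metric.ball p δ ⊆ Ain
  /-- junk thresholds (relative, in units of `√E_n`): core-loaded, loaded, running, and the
  junk CEILING of the working region -/
  jcore : ℝ
  jin : ℝ
  jrun : ℝ
  jbar : ℝ
  jcore_nonneg : 0 ≤ jcore
  jcore_lt : jcore < jin
  jrun_lt_jbar : jrun < jbar
  /-- STATICS (self-reproduction with erasure): read in `Aout` at generation `n` with running junk
  ⇒ read in `Acore` at generation `n+1` with core junk -/
  handoff : ∀ (n : ℕ) (v : L2C), read n v ∈ Aout →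
    junk n v ≤ ENNReal.ofReal (jrun * Real.sqrt (S.Emin n)) →
      read (n + 1) v ∈ Acore ∧ junk (n + 1) v ≤ ENNReal.ofReal (jcore * Real.sqrt (S.Emin (n + 1)))
  /-- STATICS: loaded states of generation `n` carry energy `≥ E_n` at frequencies `|ξ| ≥ λ_n` -/
  floor_cert : ∀ (n : ℕ) (v : L2C), read n v ∈ Ain →
    junk n v ≤ ENNReal.ofReal (jin * Real.sqrt (S.Emin n)) →
      ENNReal.ofReal (S.Emin n) ≤ highFreqEnergy (S.lam n) v
  /-- CIRCUIT: the design vector field on `O` (rescaled time) -/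
  F : O → O
  /-- the open WORKING REGION of readouts on which the local estimates are claimed -/
  U : Set O
  U_open : IsOpen U
  /-- Lipschitz constant of the vector field on the working region -/
  L : ℝ≥0
  F_lip : LipschitzOnWith L F U
  /-- the flow of `F` from `Ain`, in rescaled time -/
  Φ : ℝ → O → O
  /-- rescaled cycle time -/
  τc : ℝ
  τc_nonneg : 0 ≤ τc
  flow_zero : ∀ p ∈ Ain, Φ 0 p = p
  flow_cont : ∀ p ∈ Ain, ContinuousOn (fun σ => Φ σ p) (Icc 0 τc)
  flow_deriv : ∀ p ∈ Ain, ∀ σ ∈ Ico 0 τc,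
    HasDerivWithinAt (fun σ' => Φ σ' p) (F (Φ σ p)) (Ici σ) σ
  /-- admissible readout-velocity defect per unit rescaled time -/
  ε : ℝ
  ε_nonneg : 0 ≤ ε
  /-- shadowing tolerance = tube radius -/
  δsh : ℝ
  /-- DEFECT BUDGET: the tube radius absorbs the defect amplified by the circuit's instability over
  one cycle, `ε (e^{L τc} - 1)/L ≤ δsh` -/
  δsh_ge : gronwallBound 0 L ε τc ≤ δsh
  /-- TUBE: the closed `δsh`-neighbourhood of the circuit orbits from `Ain` over `[0, τc]` lies in
  the working region -/
  tube : ∀ p ∈ Ain, ∀ σ ∈ Icc 0 τc, Metric.closedBall (Φ σ p) δsh ⊆ U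
  /-- delayed abrupt transition with margin: from `Ain` the circuit reaches, within rescaled time
  `τc`, a point whose closed `δsh`-ball lies in `Aout` -/
  dat : ∀ p ∈ Ain, ∃ σ : ℝ, 0 ≤ σ ∧ σ ≤ τc ∧ Metric.closedBall (Φ σ p) δsh ⊆ Aout
  /-- LEAK BUDGET: junk growth rate (relative units per unit rescaled time) -/
  γ : ℝ
  γ_nonneg : 0 ≤ γ
  /-- loaded junk plus one cycle of leakage is running junk -/
  jrun_ge : jin + γ * τc ≤ jrun
  /-- CLOCK: physical time per unit rescaled time at generation `n` -/
  unit : ℕ → ℝ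
  unit_pos : ∀ n, 0 < unit n
  /-- one cycle fits in the spec's firing allowance -/
  clock : ∀ n, unit n * τc ≤ S.Tmax n
  /-- DYNAMICS (idea-bound, local, guarded): READOUT DEFECT — along every `H¹⁰_df`-mild
  Navier–Stokes trajectory, at every instant at which the state is in the generation-`n` working
  region, the readout has a right derivative whose rescaled value is `ε`-close to the design
  vector field -/
  defect : ∀ (n : ℕ) (a : L2C) (S' : ℝ) (u : ℝ → L2C), IsMildSolutionFor eulerForm a (Ico 0 S') u →
    ∀ t : ℝ, 0 ≤ t → t < S' → read n (u t) ∈ U →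
      junk n (u t) < ENNReal.ofReal (jbar * Real.sqrt (S.Emin n)) →
        ∃ W : O, HasDerivWithinAt (fun t' => read n (u t')) W (Ici t) t ∧
          ‖unit n • W - F (read n (u t))‖ ≤ ε
  /-- DYNAMICS (idea-bound, local, guarded): JUNK RATE — meanwhile the lower right Dini derivative
  of the generation-`n` junk is at most `γ √E_n / unit n` -/
  junk_rate : ∀ (n : ℕ) (a : L2C) (S' : ℝ) (u : ℝ → L2C),
    IsMildSolutionFor eulerForm a (Ico 0 S') u →
      ∀ t : ℝ, 0 ≤ t → t < S' → read n (u t) ∈ U →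
        junk n (u t) < ENNReal.ofReal (jbar * Real.sqrt (S.Emin n)) →
          ∀ ρ : ℝ, γ < ρ → ∃ᶠ t' in 𝓝[>] t,
            junk n (u t') ≤ junk n (u t) + ENNReal.ofReal (ρ * Real.sqrt (S.Emin n) * ((t' - t) / unit n))
  /-- SEED: the ignition datum -/
  u₀ : 𝓢(EuclideanSpace ℝ (Fin 3), EuclideanSpace ℝ (Fin 3))
  divFree : VectorCalculus.IsDivFree ⇑u₀
  memH10df : MemH10df (schwartzL2 u₀)
  /-- it is read in the loaded core at generation `0` … -/
  seed_read : read 0 (schwartzL2 u₀) ∈ Acore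
  /-- … with core junk -/
  seed_junk : junk 0 (schwartzL2 u₀) ≤ ENNReal.ofReal (jcore * Real.sqrt (S.Emin 0))

namespace LocalCircuit

variable {S : CascadeSpecs} {O : Type*} [NormedAddCommGroup O] [NormedSpace ℝ O] {s : ℝ}
  (A : LocalCircuit S O s)

/-! ### §2. The working region and the threshold arithmetic -/

/-- The generation-`n` **working region** guard of a state: readout in the open region `U`, junk
strictly below the ceiling `jbar √E_n`. [folklore] -/
def Guard (n : ℕ) (v : L2C) : Prop :=
  A.read n v ∈ A.U ∧ A.junk n v < ENNReal.ofReal (A.jbar * Real.sqrt (S.Emin n))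

/-- `jin ≤ jrun` (the leak over a cycle is nonnegative). [folklore] -/
theorem jin_le_jrun : A.jin ≤ A.jrun :=
  (le_add_of_nonneg_right (mul_nonneg A.γ_nonneg A.τc_nonneg)).trans A.jrun_ge

/-- `0 < jbar` (`0 ≤ jcore < jin ≤ jrun < jbar`). [folklore] -/
theorem jbar_pos : 0 < A.jbar :=
  ((A.jcore_nonneg.trans_lt A.jcore_lt).trans_le A.jin_le_jrun).trans A.jrun_lt_jbar

/-- The Grönwall bound of the design is monotone in rescaled time. [folklore] -/
theorem gronwallBound_monotone : Monotone (gronwallBound 0 (A.L : ℝ) A.ε) :=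
  gronwallBound_mono le_rfl A.ε_nonneg A.L.coe_nonneg

/-- Within a cycle the Grönwall bound is inside the tube radius. [folklore] -/
theorem gronwallBound_le_δsh {σ : ℝ} (hσ : σ ≤ A.τc) : gronwallBound 0 (A.L : ℝ) A.ε σ ≤ A.δsh :=
  (A.gronwallBound_monotone hσ).trans A.δsh_ge

/-- The tube radius is nonnegative (it dominates `gronwallBound 0 L ε τc ≥ gronwallBound 0 L ε 0 = 0`). [folklore] -/
theorem δsh_nonneg : 0 ≤ A.δsh := by
  have h := A.gronwallBound_le_δsh A.τc_nonneg
  rwa [gronwallBound_x0] at h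

/-- **The defect budget is at most `δsh / τc`**: `ε τc ≤ δsh` (`ε τc ≤ gronwallBound 0 L ε τc`). [folklore] -/
theorem ε_mul_τc_le_δsh : A.ε * A.τc ≤ A.δsh :=
  (mul_le_gronwallBound_δ0 A.L.coe_nonneg A.ε_nonneg).trans A.δsh_ge

/-- Loaded junk plus leakage for rescaled time `σ ≤ τc` is at most running junk. [folklore] -/
theorem jin_add_mul_le {σ : ℝ} (hσ : σ ≤ A.τc) : A.jin + A.γ * σ ≤ A.jrun :=
  (add_le_add_right (mul_le_mul_of_nonneg_left hσ A.γ_nonneg) _).trans A.jrun_ge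

/-- The readout of generation `n` is `(Λ/√E_n)`-Lipschitz from `L²`. [folklore] -/
theorem dist_read_le (n : ℕ) (v w : L2C) :
    dist (A.read n v) (A.read n w) ≤ A.Λ / Real.sqrt (S.Emin n) * ‖v - w‖ := by
  have hE : 0 < Real.sqrt (S.Emin n) := Real.sqrt_pos.2 (S.Emin_pos n)
  rw [div_mul_eq_mul_div, le_div_iff₀ hE]
  exact A.read_lip n v w

/-- The readout of generation `n` is continuous on `L²`. [folklore] -/
theorem read_continuous (n : ℕ) : Continuous (A.read n) := by
  refine (LipschitzWith.of_dist_le' (K := A.Λ / Real.sqrt (S.Emin n)) fun v w => ?_).continuous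
  rw [dist_eq_norm v w]
  exact A.dist_read_le n v w

/-- **Junk is `H¹⁰`-Lipschitz** with the junk modulus: `junk n w ≤ junk n v + C_n ‖w - v‖_{H¹⁰}`
(`junk_perturb`, `X^s_{λ_n} ≤ X^{10}_{λ_n} ≤ C_n H¹⁰` since `s ≤ 10`). [folklore] -/
theorem junk_le_junk_add (n : ℕ) (v w : L2C) :
    A.junk n w ≤ A.junk n v + S.junkModulus n * eFourierSobolevNorm 10 (w - v) :=
  calc A.junk n w ≤ A.junk n v + scaledSobolevNorm s (S.lam n) (w - v) := A.junk_perturb n v w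
    _ ≤ A.junk n v + scaledSobolevNorm 10 (S.lam n) (w - v) :=
        add_le_add_right (scaledSobolevNorm_mono_order A.s_le_ten _ _) _
    _ ≤ A.junk n v + S.junkModulus n * eFourierSobolevNorm 10 (w - v) :=
        add_le_add_right (scaledSobolevNorm_le_mul_eFourierSobolevNorm (by norm_num) (S.lam_pos n) _) _

/-! ### §3. Readout and junk ALONG a mild trajectory: finiteness and continuity -/

section Trajectory

variable {a : L2C} {S' : ℝ} {u : ℝ → L2C} (hu : IsMildSolutionFor eulerForm a (Ico 0 S') u)
include hu

/-- Differences of states of an `H¹⁰_df`-mild trajectory have finite `H¹⁰` norm. [folklore] -/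
theorem eFourierSobolevNorm_sub_lt_top {x y : ℝ} (hx : x ∈ Ico 0 S') (hy : y ∈ Ico 0 S') :
    eFourierSobolevNorm 10 (u x - u y) < ⊤ :=
  calc eFourierSobolevNorm 10 (u x - u y) = eFourierSobolevNorm 10 (u x + -u y) := by
        rw [sub_eq_add_neg]
    _ ≤ eFourierSobolevNorm 10 (u x) + eFourierSobolevNorm 10 (-u y) := eFourierSobolevNorm_add_le 10 _ _
    _ = eFourierSobolevNorm 10 (u x) + eFourierSobolevNorm 10 (u y) := by rw [eFourierSobolevNorm_neg]
    _ < ⊤ := ENNReal.add_lt_top.2 ⟨(hu.1 x hx).1, (hu.1 y hy).1⟩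

/-- Junk finite at one instant of a mild trajectory is finite at every instant. [folklore] -/
theorem junk_ne_top (n : ℕ) {t : ℝ} (ht : t ∈ Ico 0 S') (hfin : A.junk n (u t) ≠ ⊤) {x : ℝ}
    (hx : x ∈ Ico 0 S') : A.junk n (u x) ≠ ⊤ :=
  ne_top_of_le_ne_top (ENNReal.add_ne_top.2 ⟨hfin, ENNReal.mul_ne_top (S.junkModulus_ne_top n)
    (eFourierSobolevNorm_sub_lt_top hu hx ht).ne⟩) (A.junk_le_junk_add n (u t) (u x))

/-- **Junk is continuous along a mild trajectory** (where finite): `H¹⁰`-continuity of the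
trajectory and the `H¹⁰`-Lipschitz bound `junk_le_junk_add`. [folklore] -/
theorem junk_tendsto (n : ℕ) {x : ℝ} (hx : x ∈ Ico 0 S') (hfin : A.junk n (u x) ≠ ⊤) :
    Tendsto (fun y => A.junk n (u y)) (𝓝[Ico 0 S'] x) (𝓝 (A.junk n (u x))) := by
  have hQ : Tendsto (fun y => S.junkModulus n * eFourierSobolevNorm 10 (u y - u x))
      (𝓝[Ico 0 S'] x) (𝓝 0) := by
    have h := ENNReal.Tendsto.const_mul (hu.2.1 x hx) (Or.inr (S.junkModulus_ne_top n))
    rwa [mul_zero] at h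
  rw [ENNReal.tendsto_nhds hfin]
  intro e he
  filter_upwards [(tendsto_order.1 hQ).2 e he] with y hy
  refine ⟨tsub_le_iff_right.2 ?_, ?_⟩
  · calc A.junk n (u x) ≤ A.junk n (u y) + S.junkModulus n * eFourierSobolevNorm 10 (u x - u y) :=
          A.junk_le_junk_add n (u y) (u x)
      _ = A.junk n (u y) + S.junkModulus n * eFourierSobolevNorm 10 (u y - u x) := by
          rw [eFourierSobolevNorm_sub_comm]
      _ ≤ A.junk n (u y) + e := add_le_add_right hy.le _
  · calc A.junk n (u y) ≤ A.junk n (u x) + S.junkModulus n * eFourierSobolevNorm 10 (u y - u x) :=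
          A.junk_le_junk_add n (u x) (u y)
      _ ≤ A.junk n (u x) + e := add_le_add_right hy.le _

/-- The real-valued junk is continuous along a mild trajectory (where finite). [folklore] -/
theorem junk_toReal_continuousWithinAt (n : ℕ) {x : ℝ} (hx : x ∈ Ico 0 S')
    (hfin : A.junk n (u x) ≠ ⊤) :
    ContinuousWithinAt (fun y => (A.junk n (u y)).toReal) (Ico 0 S') x :=
  (ENNReal.tendsto_toReal hfin).comp (A.junk_tendsto hu n hx hfin)

/-- The readout is continuous along a mild trajectory. [folklore] -/
theorem read_continuousOn (n : ℕ) : ContinuousOn (fun y => A.read n (u y)) (Ico 0 S') :=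
  (A.read_continuous n).comp_continuousOn hu.2.1.continuousOn

/-! ### §4. The two GUARDED estimates -/

/-- **GUARDED SHADOWING** (Grönwall for approximate trajectories, in rescaled time): along a mild
trajectory read in `Ain` at time `t ≥ 0`, if the state stays in the generation-`n` working region
for physical times `[t, t + unit n · σT)`, `σT ≤ τc`, then for every rescaled `σ ∈ [0, σT]` the
readout at `t + unit n · σ` is within `gronwallBound 0 L ε σ` of the circuit orbit `Φ σ` of the
initial readout (`defect` makes the rescaled readout an `ε`-approximate trajectory of `F` inside
`U`, where `F` is `L`-Lipschitz; the circuit orbit is an exact one, inside `U` by `tube`). [folklore] -/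
theorem dist_le_gronwallBound_of_guard (n : ℕ) {t : ℝ} (ht : 0 ≤ t) (hin : A.read n (u t) ∈ A.Ain)
    {σT : ℝ} (hσT : σT ≤ A.τc) (hS' : t + A.unit n * σT < S')
    (hG : ∀ x ∈ Ico t (t + A.unit n * σT), A.Guard n (u x)) :
    ∀ σ ∈ Icc 0 σT, dist (A.read n (u (t + A.unit n * σ))) (A.Φ σ (A.read n (u t))) ≤
      gronwallBound 0 (A.L : ℝ) A.ε σ := by
  have hun := A.unit_pos n
  -- physical times of rescaled instants
  have hphys : ∀ σ ∈ Ico 0 σT, t + A.unit n * σ ∈ Ico t (t + A.unit n * σT) := fun σ hσ =>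
    ⟨le_add_of_nonneg_right (mul_nonneg hun.le hσ.1),
      add_lt_add_right (mul_lt_mul_of_pos_left hσ.2 hun) t⟩
  have hphys' : ∀ σ ∈ Ico 0 σT, 0 ≤ t + A.unit n * σ ∧ t + A.unit n * σ < S' := fun σ hσ =>
    ⟨ht.trans (hphys σ hσ).1, (hphys σ hσ).2.trans hS'⟩
  have hW : ∀ σ ∈ Ico 0 σT, ∃ W : O,
      HasDerivWithinAt (fun t' => A.read n (u t')) W (Ici (t + A.unit n * σ)) (t + A.unit n * σ) ∧
        ‖A.unit n • W - A.F (A.read n (u (t + A.unit n * σ)))‖ ≤ A.ε := fun σ hσ =>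
    A.defect n a S' u hu _ (hphys' σ hσ).1 (hphys' σ hσ).2 (hG _ (hphys σ hσ)).1
      (hG _ (hphys σ hσ)).2
  choose! W hW using hW
  have hcont : ContinuousOn (fun σ => A.read n (u (t + A.unit n * σ))) (Icc 0 σT) := by
    refine (A.read_continuousOn hu n).comp (by fun_prop) fun σ hσ => ⟨?_, ?_⟩
    · exact add_nonneg ht (mul_nonneg hun.le hσ.1)
    · exact (add_le_add_right (mul_le_mul_of_nonneg_left hσ.2 hun.le) t).trans_lt hS'
  have hderiv : ∀ σ ∈ Ico 0 σT, HasDerivWithinAt (fun σ => A.read n (u (t + A.unit n * σ)))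
      (A.unit n • W σ) (Ici σ) σ := by
    intro σ hσ
    have hh : HasDerivWithinAt (fun z : ℝ => t + A.unit n * z) (A.unit n) (Ici σ) σ := by
      simpa using ((hasDerivWithinAt_id σ (Ici σ)).const_mul (A.unit n)).const_add t
    exact (hW σ hσ).1.scomp σ hh fun z hz => add_le_add_right (mul_le_mul_of_nonneg_left hz hun.le) t
  have key := dist_le_of_approx_trajectories_ODE_of_mem
    (v := fun _ => A.F) (s := fun _ => A.U) (K := A.L)
    (f := fun σ => A.read n (u (t + A.unit n * σ))) (f' := fun σ => A.unit n • W σ)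
    (g := fun σ => A.Φ σ (A.read n (u t))) (g' := fun σ => A.F (A.Φ σ (A.read n (u t))))
    (a := 0) (b := σT) (εf := A.ε) (εg := 0) (δ := 0)
    (fun _ _ => A.F_lip) hcont hderiv
    (fun σ hσ => by rw [dist_eq_norm]; exact (hW σ hσ).2)
    (fun σ hσ => (hG _ (hphys σ hσ)).1)
    ((A.flow_cont _ hin).mono (Icc_subset_Icc_right hσT))
    (fun σ hσ => A.flow_deriv _ hin σ ⟨hσ.1, hσ.2.trans_le hσT⟩)
    (fun σ _ => (dist_self _).le)
    (fun σ hσ => A.tube _ hin σ ⟨hσ.1, hσ.2.le.trans hσT⟩ (Metric.mem_closedBall_self A.δsh_nonneg))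
    (by simp only [mul_zero, add_zero, A.flow_zero _ hin, dist_self, le_refl])
  intro σ hσ
  simpa only [add_zero, sub_zero] using key σ hσ

/-- **GUARDED LEAKAGE** (a Dini-derivative fence): along a mild trajectory with finite
generation-`n` junk at time `t ≥ 0`, if the state stays in the working region for physical times
`[t, T)`, `T < S'`, then on `[t, T]` the junk grows at most linearly at rate `γ √E_n / unit n`
(`junk_rate` bounds the lower right Dini derivative by `ρ √E_n / unit n` for every `ρ > γ`;
`image_le_of_liminf_slope_right_lt_deriv_boundary'` fences; let `ρ → γ⁺`). [folklore] -/
theorem junk_toReal_le_of_guard (n : ℕ) {t T : ℝ} (ht : 0 ≤ t) (hT : T < S')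
    (hfin : A.junk n (u t) ≠ ⊤) (hG : ∀ x ∈ Ico t T, A.Guard n (u x)) :
    ∀ x ∈ Icc t T, (A.junk n (u x)).toReal ≤
      (A.junk n (u t)).toReal + A.γ * (Real.sqrt (S.Emin n) / A.unit n) * (x - t) := by
  intro x hx
  have htT : t ≤ T := hx.1.trans hx.2
  have hun := A.unit_pos n
  have hE : 0 < Real.sqrt (S.Emin n) := Real.sqrt_pos.2 (S.Emin_pos n)
  set c : ℝ := Real.sqrt (S.Emin n) / A.unit n with hc
  have hc0 : 0 < c := div_pos hE hun
  have hI : Icc t T ⊆ Ico 0 S' := fun y hy => ⟨ht.trans hy.1, hy.2.trans_lt hT⟩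
  set J : ℝ → ℝ := fun y => (A.junk n (u y)).toReal with hJ
  have hJc : ContinuousOn J (Icc t T) := fun y hy =>
    (A.junk_toReal_continuousWithinAt hu n (hI hy)
      (A.junk_ne_top hu n (hI ⟨le_rfl, htT⟩) hfin (hI hy))).mono hI
  -- fence with slope `ρ c` for every `ρ > γ`
  have key : ∀ ρ, A.γ < ρ → J x ≤ J t + ρ * c * (x - t) := by
    intro ρ hρ
    refine image_le_of_liminf_slope_right_lt_deriv_boundary' (f := J) (f' := fun _ => A.γ * c)
      (a := t) (b := T) hJc ?_ (B := fun y => J t + ρ * c * (y - t)) (B' := fun _ => ρ * c)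
      (by simp) (by fun_prop) ?_ (fun _ _ _ => mul_lt_mul_of_pos_right hρ hc0) hx
    · intro y hy r hr
      obtain ⟨r', hr'1, hr'2⟩ := exists_between hr
      have hr'0 : 0 < r' := (mul_nonneg A.γ_nonneg hc0.le).trans_lt hr'1
      have hρ' : A.γ < r' / c := by rwa [lt_div_iff₀ hc0]
      have hy0 : 0 ≤ y := ht.trans hy.1
      have hyS : y < S' := hy.2.trans hT
      have hfreq := A.junk_rate n a S' u hu y hy0 hyS (hG y hy).1 (hG y hy).2 (r' / c) hρ'
      have hev : ∀ᶠ z in 𝓝[>] y, y < z := eventually_nhdsWithin_of_forall fun z hz => hz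
      refine (hfreq.and_eventually hev).mono fun z hz => ?_
      obtain ⟨hz, hyz⟩ := hz
      have hyfin : A.junk n (u y) ≠ ⊤ := (hG y hy).2.ne_top
      have hq : 0 ≤ r' / c * Real.sqrt (S.Emin n) * ((z - y) / A.unit n) :=
        mul_nonneg (mul_nonneg (div_nonneg hr'0.le hc0.le) hE.le)
          (div_nonneg (sub_nonneg.2 hyz.le) hun.le)
      have hcc : r' / c * Real.sqrt (S.Emin n) * ((z - y) / A.unit n) = r' * (z - y) := by
        rw [hc]; field_simp
      have hJz : J z ≤ J y + r' * (z - y) := by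
        have h1 := ENNReal.toReal_mono (ENNReal.add_ne_top.2 ⟨hyfin, ENNReal.ofReal_ne_top⟩) hz
        rw [ENNReal.toReal_add hyfin ENNReal.ofReal_ne_top, ENNReal.toReal_ofReal hq, hcc] at h1
        exact h1
      rw [slope_def_field]
      calc (J z - J y) / (z - y) ≤ r' := by rw [div_le_iff₀ (sub_pos.2 hyz)]; linarith
        _ < r := hr'2
    · intro y _
      have h := (((hasDerivWithinAt_id y (Ici y)).sub_const t).const_mul (ρ * c)).const_add (J t)
      simpa using h
  -- let `ρ → γ⁺`
  have htend : Tendsto (fun ρ => J t + ρ * c * (x - t)) (𝓝[>] A.γ) (𝓝 (J t + A.γ * c * (x - t))) :=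
    ((by fun_prop : Continuous fun ρ : ℝ => J t + ρ * c * (x - t)).tendsto A.γ).mono_left
      nhdsWithin_le_nhds
  exact ge_of_tendsto htend (eventually_nhdsWithin_of_forall fun ρ hρ => key ρ hρ)

end Trajectory

end LocalCircuit

end Literature.Analysis.FluidPDE.FluidComputer

end
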